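import Literature.MathematicalPhysics.QuantumFieldTheory.Balaban1983to89.Node00.RateRecord11

/-!
# NODE 00 (YM-PLAN Track A) — THE RATE-RECORD HOME AT STAGE 11, layer A, LEAF §9: N16's NE3 UNIT-LATTICE DATA OF THE RECORD —
# the torus → periodic-`ℤ⁴` configuration dictionary (Literature twin of SUBSTRATE V3's `liftCfg`), the period of record of the step-`k`
# lattice of the `K`-th approximation, the data of record `ne3DomOfRecord₁₁ F N K k` (ALL `p`-periodic `SU(N)`-valued unit-lattice
# configurations, proved), the pinned NE3 object `NE3Objects₁₁.ofRecord` (letters parametric) and THE CONSTANT LAYER OF RECORD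
# `ne3ConstLayerOfRecord₁₁` (`K − k = 0`: the physical unit torus `2·L^m`, the cell's reading of record)

Cell `pub-ymgap`, NODE 00, definer seat `pub-ymgap-node00-def-RR-1` (the PEN of the rate-record home; R141 (A)), generation 4; INTENT-3 = pub-ymgap
INBOX l.13602 (2026-08-26).  A LEAF of `Node00/RateRecord11.lean` (v1.1, p461303): it imports that module ONLY and is imported by nobody yet, so it
rebuilds none of the home's consumers (director LINE №102 ∕ №103 farm hygiene).  TRIGGER OF RECORD: dag-n16-e (g2) LOCATED-1, INBOX l.13400 («the
CONFIGURATION dictionary torus → periodic ℤ⁴ EXISTS … so `NE3Objects₁₁.dom := liftCfg '' (record's unit-lattice data)` is typable; the letters are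
`InEndRegime`'s; the averaging question is NOT RR-1's to bridge») and dag-ref-B's census of the home requirement (INBOX l.13376: «pin `R.ne3.dom` to the
consumers' data; `Nper` per family»).  [Balaban1987RG1] = T. Bałaban, *Renormalization group approach to lattice gauge field theories. I*, Commun. Math.
Phys. **109** (1987) 249–301; [Balaban1985Averaging] = *Averaging operations for lattice gauge theories*, Commun. Math. Phys. **98** (1985) 17–51;
[Balaban1985UV3] = *Ultraviolet stability of three-dimensional lattice pure gauge field theories*, Commun. Math. Phys. **102** (1985) 255–275
((1)–(3) p. 256: the letters of `NE3Objects₁₁`, v1.1 §3).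

WHAT THIS LEAF TYPES (total definitions, `rfl` ∕ `Iff.rfl` faces, kernel facts about tori and `ZMod`; NO estimate, NO node statement).
§1 THE DICTIONARY.  `toTorusSite₁₁ P j x` = the site of the torus `T^{(j)}` under the `ℤ^d` site `x` (coordinatewise reduction modulo
   `N_j = P.sitesPerDir j = 2·L^{m+K−j}`, [Balaban1987RG1] (0.1) p. 251) and `liftCfg₁₁ j ι U x κ = ι (U ⟨toTorusSite₁₁ P j x, κ⟩)` = the torus gauge field
   `U : GaugeField P j G` ([Balaban1985Averaging] (6)–(7) p. 18: configurations on bonds with values in `G ⊂ U(N)`, `U(b⁻¹) = U(b)*`) READ AS A PERIODIC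
   CONFIGURATION ON `ℤ^d` through a monoid morphism `ι : G →* H` — the SAME BODIES as the SUBSTRATE cell's `Support/SubstrateVocabularyV3.toZMod ∕
   .liftCfg` (Summits-side, not importable under `Literature/`), so that layer B (`Summits/…/Theorems/BalabanUVNodesRateCarriersOfRecord11.lean`)
   bridges `liftCfg₁₁ j ι U = SubstrateVocabularyV3.liftCfg ι U` by `rfl` and inherits
   that module's `isPeriodicCfg_liftCfg ∕ isUnitaryCfg_liftCfg ∕ hol_liftCfg ∕ smallField_liftCfg_iff` BY NAME.  Periodicity is stated here for EVERY
   integer vector (`toTorusSite₁₁_add_period_smul`, `liftCfg₁₁_add_period_smul`), the section `toTorusSite₁₁ (val ∘ s) = s` and surjectivity.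
§2 THE PERIOD OF RECORD.  `ne3NperOfRecord₁₁ F K k = (F.P K).sitesPerDir k = 2·L^{m+K−k}`: the number of sites per direction of the step-`k` lattice
   `T^{(k)}` of the `K`-th approximation — N16's letter `Nper` AT THE RECORD; it sees `K − k` only (`ne3NperOfRecord₁₁_succ`), `2 ≤` it (so THE END's
   regime clause «`1 ≤ c.Nper`» of `Thm/…N16RegimeDefs.InEndRegime` holds at the record letter-level; `InEndRegime` itself — with its Summits-CHOSEN
   `radiusOfRecord ∕ constOfRecord` — is NOT restated here).
§3 THE DATA OF RECORD.  `liftCfgOfRecord₁₁ F N K k V := liftCfg₁₁ k (ιSU N) V` at the `ℤ⁴` types (bridge `rfl`) and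
   `ne3DomOfRecord₁₁ F N K k := Set.range (liftCfgOfRecord₁₁ F N K k)`: the lifts through the embedding
   `ιSU : SU(N) →* M_N(ℂ)ˣ` (`Node00/Record11.lean`) of the record's step-`k` configurations `cfgOfRecord F N K k = GaugeField (F.P K) k SU(N)`
   (`Node00/DatumAvLayer.lean`; [Balaban1987RG1] (0.1)) — a `Set ((Fin 4 → ℤ) → Fin 4 → M_N(ℂ)ˣ)`, the type of `NE3Objects₁₁.dom` ((F.P K).d = 4
   definitionally).  PROVED INTRINSIC READING `ne3DomOfRecord₁₁_eq_setOf`: it is EXACTLY the set of `p`-periodic (`p = ne3NperOfRecord₁₁ F K k`, every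
   integer vector) configurations with values in `SU(N)`; hence `ne3DomOfRecord₁₁_succ` (`(K+1, k+1)` and `(K, k)` give the same data), non-emptiness,
   and the two membership consequences consumers quote (`periodic_of_mem_…`, `coe_mem_specialUnitaryGroup_of_mem_…`).
§4 THE PINNED OBJECT.  `NE3Letters₁₁ = (ε, b, g, C, Λ₁, Λ₂')` (N16's analytic letters — PARAMETERS: they are THE END's, named Summits-side by
   `InEndRegime`), `NE3Objects₁₁.letters`, `NE3Objects₁₁.ofRecord F N K k ℓ := ⟨ne3NperOfRecord₁₁ F K k, ℓ.ε, …, ne3DomOfRecord₁₁ F N K k⟩` with its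
   `rfl` faces, `populated_ofRecord` (v1.1 §8's `NE3Objects₁₁.Populated`) and `ofRecord_succ`.
§5 THE CONSTANT LAYER OF RECORD (the cell's READING OF RECORD, dag-n16-e ANSWER-RR1 INBOX l.13645 (2), dag-lead DEDUP-198 l.13671 CONFIRMED).
   `NE3Objects₁₁.ofRecord_diag` (`ofRecord F N K K ℓ = ofRecord F N 0 0 ℓ`: the diagonal `K − k = 0` is `K`-free), `ne3ConstLayerOfRecord₁₁ F N ℓ :=
   ofRecord F N 0 0 ℓ` (`Nper = 2·L^m` = the PHYSICAL unit torus of every run's last step; `dom` = all `2·L^m`-periodic `SU(N)` data,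
   `mem_ne3ConstLayerOfRecord₁₁_dom_iff`; populated; `1 ≤ Nper`), `ofRecord_self_eq_ne3ConstLayerOfRecord₁₁`, and the constant reading
   `ne3ConstReadingOfRecord₁₁ F N ℓ := fun _ => ne3ConstLayerOfRecord₁₁ F N ℓ` (`_apply` = `rfl`, so a consumer's `hconst` is `rfl`;
   `_eq_ofRecord_self`: at run length `k` it IS the object of record of that run's last step `(k, k)`).

THE INDEXING, DECIDED FOR THE RECORD (dag-n16-e ANSWER-RR1 l.13645 (2); dag-lead DEDUP-198 l.13671).  The venue decl `YMDAG.UVSplit.N16At c` fixes ONE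
period `c.Nper` and ITSELF quantifies every depth `k ≥ 1` BELOW it (the continuum direction), while the record's step-`k` unit lattice of approximation `K`
has period `2·L^{m+K−k}`: a fixed-`Nper` bundle is a fixed `K − k` ACROSS approximations, and the reading of record is `K − k = 0` — the physical unit lattice
`2·L^m` of every run's last step, CONSTANT in the run length (§5).  This leaf gives the data at every `(K, k)` (§3–§4), their `succ`-∕`diag`-invariance and
the constant layer ∕ reading by name; WHICH letters `ℓ` a family carries stays the consumer's (free inside `InEndRegime`, ANSWER-RR1 (3)).  No statement
about averaging operations ((0.4) of record vs [Balaban1985Averaging] (42)) is made or needed here (dag-n16-e l.13400: not RR-1's to bridge).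

HONEST FRAMING.  Definitions and kernel facts about finite tori; nothing of Bałaban's is asserted; N16 is NOT discharged by anything here; one finite `T⁴`
programme at fixed `ε`, Bałaban as printed — nothing continuum ∕ `ℝ⁴` ∕ OS ∕ mass-gap ∕ Clay; count-neutral.  No `sorry`, no `instance`, no `notation`,
no attribute removed; `--kind definition --supports stmt-QuantumFields-19673` (K0 `Record11Inhabited`, the definers' row).
-/

noncomputable section

namespace Literature.MathematicalPhysics.QuantumFieldTheory.Balaban1983to89.Node00

open T4Continuum

/-! ## §1. The dictionary: `ℤ^d` sites ↦ torus sites; torus gauge fields ↦ periodic configurations -/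

section Dictionary

variable {P : Params} {j : ℕ}

/-- **`ℤ^d` SITE ↦ SITE OF THE TORUS `T^{(j)}`**: coordinatewise reduction modulo `N_j = P.sitesPerDir j`.  Same body as the SUBSTRATE cell's
`SubstrateVocabularyV3.toZMod` (Summits-side); layer B bridges by `rfl`. [cite: Balaban1987RG1, (0.1) p.251] -/
def toTorusSite₁₁ (P : Params) (j : ℕ) (x : Fin P.d → ℤ) : Site P j :=
  fun μ => ((x μ : ℤ) : ZMod (P.sitesPerDir j))

/-- `toTorusSite₁₁` coordinatewise (`rfl`). [cite: Balaban1987RG1, (0.1) p.251 (bookkeeping)] -/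
theorem toTorusSite₁₁_apply (x : Fin P.d → ℤ) (μ : Fin P.d) :
    toTorusSite₁₁ P j x μ = ((x μ : ℤ) : ZMod (P.sitesPerDir j)) := rfl

/-- **PERIODICITY IN EVERY INTEGER DIRECTION**: translating the `ℤ^d` site by `N_j • v`, `v` ANY integer vector, does not move its torus site.
[cite: Balaban1987RG1, (0.1) p.251 (bookkeeping)] -/
theorem toTorusSite₁₁_add_period_smul (x v : Fin P.d → ℤ) :
    toTorusSite₁₁ P j (x + (P.sitesPerDir j : ℤ) • v) = toTorusSite₁₁ P j x := by
  funext μ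
  simp [toTorusSite₁₁_apply, Pi.add_apply]

/-- **THE SECTION**: the `ℤ^d` site of least non-negative representatives of a torus site reduces back to it. [cite: Balaban1987RG1, (0.1) p.251 (bookkeeping)] -/
theorem toTorusSite₁₁_natCast_val (s : Site P j) :
    toTorusSite₁₁ P j (fun μ => ((s μ).val : ℤ)) = s := by
  funext μ
  simp [toTorusSite₁₁_apply]

/-- Every torus site is the reduction of a `ℤ^d` site. [cite: Balaban1987RG1, (0.1) p.251 (bookkeeping)] -/
theorem toTorusSite₁₁_surjective (P : Params) (j : ℕ) : Function.Surjective (toTorusSite₁₁ P j) :=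
  fun s => ⟨fun μ => ((s μ).val : ℤ), toTorusSite₁₁_natCast_val s⟩

/-- Two `ℤ^d` sites with the same torus site differ by `N_j • v` for some integer vector `v`. [cite: Balaban1987RG1, (0.1) p.251 (bookkeeping)] -/
theorem exists_eq_add_period_smul_of_toTorusSite₁₁_eq {x x' : Fin P.d → ℤ}
    (h : toTorusSite₁₁ P j x = toTorusSite₁₁ P j x') : ∃ v : Fin P.d → ℤ, x' = x + (P.sitesPerDir j : ℤ) • v := by
  have hμ : ∀ μ, (P.sitesPerDir j : ℤ) ∣ x' μ - x μ := by
    intro μ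
    have := congrFun h μ
    rw [toTorusSite₁₁_apply, toTorusSite₁₁_apply] at this
    exact (ZMod.intCast_eq_intCast_iff_dvd_sub (x μ) (x' μ) (P.sitesPerDir j)).1 this
  choose v hv using hμ
  refine ⟨v, funext fun μ => ?_⟩
  have := hv μ
  simp only [Pi.add_apply, Pi.smul_apply, smul_eq_mul]
  linarith

variable {G H : Type*} [MulOneClass G] [MulOneClass H]

/-- **THE PERIODIC LIFT OF A TORUS GAUGE FIELD** through a monoid morphism `ι : G →* H` (for the record: `ι = ιSU N : SU(N) →* M_N(ℂ)ˣ`): the bond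
variable at the `ℤ^d` bond `⟨x, x + e_κ⟩` is `ι` of the bond variable at the torus bond under it.  Same body as the SUBSTRATE cell's
`SubstrateVocabularyV3.liftCfg` (Summits-side); layer B bridges by `rfl`. [cite: Balaban1985Averaging, (6)–(7) p.18] -/
def liftCfg₁₁ (j : ℕ) (ι : G →* H) (U : GaugeField P j G) : (Fin P.d → ℤ) → Fin P.d → H :=
  fun x κ => ι (U ⟨toTorusSite₁₁ P j x, κ⟩)

/-- `liftCfg₁₁` unfolded (`rfl`). [cite: Balaban1985Averaging, (6)–(7) p.18 (bookkeeping)] -/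
theorem liftCfg₁₁_apply (ι : G →* H) (U : GaugeField P j G) (x : Fin P.d → ℤ) (κ : Fin P.d) :
    liftCfg₁₁ j ι U x κ = ι (U ⟨toTorusSite₁₁ P j x, κ⟩) := rfl

/-- **THE LIFT IS `N_j`-PERIODIC IN EVERY INTEGER DIRECTION.** [cite: Balaban1985Averaging, (6)–(7) p.18 (bookkeeping)] -/
theorem liftCfg₁₁_add_period_smul (ι : G →* H) (U : GaugeField P j G) (x v : Fin P.d → ℤ) (κ : Fin P.d) :
    liftCfg₁₁ j ι U (x + (P.sitesPerDir j : ℤ) • v) κ = liftCfg₁₁ j ι U x κ := by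
  rw [liftCfg₁₁_apply, liftCfg₁₁_apply, toTorusSite₁₁_add_period_smul]

/-- The lift depends on the `ℤ^d` site only through its torus site. [cite: Balaban1985Averaging, (6)–(7) p.18 (bookkeeping)] -/
theorem liftCfg₁₁_eq_of_toTorusSite₁₁_eq (ι : G →* H) (U : GaugeField P j G) {x x' : Fin P.d → ℤ}
    (h : toTorusSite₁₁ P j x = toTorusSite₁₁ P j x') : liftCfg₁₁ j ι U x = liftCfg₁₁ j ι U x' := by
  funext κ
  rw [liftCfg₁₁_apply, liftCfg₁₁_apply, h]

/-- The lift at the section of a torus site reads the torus bond variable there. [cite: Balaban1985Averaging, (6)–(7) p.18 (bookkeeping)] -/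
theorem liftCfg₁₁_natCast_val (ι : G →* H) (U : GaugeField P j G) (s : Site P j) (κ : Fin P.d) :
    liftCfg₁₁ j ι U (fun μ => ((s μ).val : ℤ)) κ = ι (U ⟨s, κ⟩) := by
  rw [liftCfg₁₁_apply, toTorusSite₁₁_natCast_val]

end Dictionary

/-! ## §2. The period of record of the step-`k` lattice of the `K`-th approximation -/

section Period

variable (F : T4Family)

/-- **N16's PERIOD `Nper` AT THE RECORD**: the number of sites per direction of the step-`k` lattice `T^{(k)}` of the `K`-th approximation,
`(F.P K).sitesPerDir k = 2·L^{m+K−k}`. [cite: Balaban1987RG1, (0.1) p.251] -/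
def ne3NperOfRecord₁₁ (K k : ℕ) : ℕ := (F.P K).sitesPerDir k

/-- Face (`rfl`): it is `Setup`'s `sitesPerDir`. [cite: Balaban1987RG1, (0.1) p.251 (bookkeeping)] -/
theorem ne3NperOfRecord₁₁_def (K k : ℕ) : ne3NperOfRecord₁₁ F K k = (F.P K).sitesPerDir k := rfl

/-- Face: `Nper = 2·L^{m+K−k}`. [cite: Balaban1987RG1, (0.1) p.251 (bookkeeping)] -/
theorem ne3NperOfRecord₁₁_eq (K k : ℕ) : ne3NperOfRecord₁₁ F K k = 2 * F.L ^ (F.m + K - k) := rfl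

/-- **THE PERIOD SEES `K − k` ONLY**: the step-`(k+1)` lattice of the `(K+1)`-th approximation has the period of the step-`k` lattice of the `K`-th.
[cite: Balaban1987RG1, (0.1) p.251 (bookkeeping)] -/
theorem ne3NperOfRecord₁₁_succ (K k : ℕ) : ne3NperOfRecord₁₁ F (K + 1) (k + 1) = ne3NperOfRecord₁₁ F K k := by
  rw [ne3NperOfRecord₁₁_eq, ne3NperOfRecord₁₁_eq]
  congr 2
  omega

/-- At the last step `k = K` the period is the physical unit lattice's, `2·L^m`, for EVERY approximation. [cite: Balaban1987RG1, (0.1) p.251 (bookkeeping)] -/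
theorem ne3NperOfRecord₁₁_self (K : ℕ) : ne3NperOfRecord₁₁ F K K = 2 * F.L ^ F.m := by
  rw [ne3NperOfRecord₁₁_eq]
  congr 2
  omega

/-- `2 ≤ Nper` at the record. [cite: Balaban1987RG1, (0.1) p.251 (bookkeeping)] -/
theorem two_le_ne3NperOfRecord₁₁ (K k : ℕ) : 2 ≤ ne3NperOfRecord₁₁ F K k := by
  rw [ne3NperOfRecord₁₁_eq]
  have hL : 1 ≤ F.L := by have := F.hL11; omega
  have : 1 ≤ F.L ^ (F.m + K - k) := Nat.one_le_pow _ _ hL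
  omega

/-- `1 ≤ Nper` at the record — THE END's regime clause «`1 ≤ c.Nper`» (`Thm/…N16RegimeDefs.InEndRegime`, Summits-side) read letter-level.
[cite: Balaban1987RG1, (0.1) p.251 (bookkeeping)] -/
theorem one_le_ne3NperOfRecord₁₁ (K k : ℕ) : 1 ≤ ne3NperOfRecord₁₁ F K k :=
  le_trans (by norm_num) (two_le_ne3NperOfRecord₁₁ F K k)

/-- `0 < Nper` at the record. [cite: Balaban1987RG1, (0.1) p.251 (bookkeeping)] -/
theorem ne3NperOfRecord₁₁_pos (K k : ℕ) : 0 < ne3NperOfRecord₁₁ F K k :=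
  one_le_ne3NperOfRecord₁₁ F K k

end Period

/-! ## §3. The NE3 unit-lattice data of the record -/

section Data

variable (F : T4Family) (N : ℕ)

/-- **THE RECORD'S LIFT** at approximation `K`, step `k`: `liftCfg₁₁ k (ιSU N)` on the record's step-`k` configurations
`cfgOfRecord F N K k = GaugeField (F.P K) k SU(N)`, at the `ℤ⁴` types of `NE3Objects₁₁.dom` (`(F.P K).d = 4` definitionally; stating the types
as `Fin 4` once here keeps every later face syntactically well-typed). [cite: Balaban1987RG1, (0.1) p.251] -/
def liftCfgOfRecord₁₁ (K k : ℕ) (V : cfgOfRecord F N K k) : (Fin 4 → ℤ) → Fin 4 → (MatA N)ˣ :=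
  fun x κ => ιSU N (V ⟨toTorusSite₁₁ (F.P K) k x, κ⟩)

/-- `liftCfgOfRecord₁₁` unfolded (`rfl`). [cite: Balaban1987RG1, (0.1) p.251 (bookkeeping)] -/
theorem liftCfgOfRecord₁₁_apply (K k : ℕ) (V : cfgOfRecord F N K k) (x : Fin 4 → ℤ) (κ : Fin 4) :
    liftCfgOfRecord₁₁ F N K k V x κ = ιSU N (V ⟨toTorusSite₁₁ (F.P K) k x, κ⟩) := rfl

/-- The matrix under the record's lift is the torus bond variable (`rfl`). [cite: Balaban1987RG1, (0.1) p.251 (bookkeeping)] -/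
theorem coe_liftCfgOfRecord₁₁_apply (K k : ℕ) (V : cfgOfRecord F N K k) (x : Fin 4 → ℤ) (κ : Fin 4) :
    ((liftCfgOfRecord₁₁ F N K k V x κ : (MatA N)ˣ) : MatA N) = ((V ⟨toTorusSite₁₁ (F.P K) k x, κ⟩ : SU N) : MatA N) := rfl

/-- **BRIDGE (`rfl`)**: the record's lift IS the generic lift `liftCfg₁₁ k (ιSU N)` (hence, in layer B, SUBSTRATE V3's `liftCfg (ιSU N)` by `rfl`).
[cite: Balaban1987RG1, (0.1) p.251 (bookkeeping)] -/
theorem liftCfgOfRecord₁₁_eq_liftCfg₁₁ (K k : ℕ) (V : cfgOfRecord F N K k) :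
    liftCfgOfRecord₁₁ F N K k V = liftCfg₁₁ k (ιSU N) V := rfl

/-- **THE RECORD'S LIFT IS `Nper`-PERIODIC IN EVERY INTEGER DIRECTION.** [cite: Balaban1987RG1, (0.1) p.251 (bookkeeping)] -/
theorem liftCfgOfRecord₁₁_add_period_smul (K k : ℕ) (V : cfgOfRecord F N K k) (x v : Fin 4 → ℤ) (κ : Fin 4) :
    liftCfgOfRecord₁₁ F N K k V (x + (ne3NperOfRecord₁₁ F K k : ℤ) • v) κ = liftCfgOfRecord₁₁ F N K k V x κ :=
  liftCfg₁₁_add_period_smul (P := F.P K) (ιSU N) V x v κ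

/-- **THE RECORD'S LIFT IS `SU(N)`-VALUED** (through `M_N(ℂ)ˣ`). [cite: Balaban1987RG1, pp.251–252 (bookkeeping)] -/
theorem coe_liftCfgOfRecord₁₁_mem_specialUnitaryGroup (K k : ℕ) (V : cfgOfRecord F N K k) (x : Fin 4 → ℤ) (κ : Fin 4) :
    ((liftCfgOfRecord₁₁ F N K k V x κ : (MatA N)ˣ) : MatA N) ∈ Matrix.specialUnitaryGroup (Fin N) ℂ :=
  (V ⟨toTorusSite₁₁ (F.P K) k x, κ⟩).2

/-- **N16's NE3 UNIT-LATTICE DATA OF THE RECORD** at approximation `K`, step `k`: the periodic-`ℤ⁴` lifts through `ιSU : SU(N) →* M_N(ℂ)ˣ` of the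
record's step-`k` configurations `cfgOfRecord F N K k = GaugeField (F.P K) k SU(N)` — a set of the type of `NE3Objects₁₁.dom`.
[cite: Balaban1987RG1, (0.1) p.251] -/
def ne3DomOfRecord₁₁ (K k : ℕ) : Set ((Fin 4 → ℤ) → Fin 4 → (MatA N)ˣ) :=
  Set.range (liftCfgOfRecord₁₁ F N K k)

variable {F N}

/-- Membership (`Iff.rfl`): a configuration is a datum of record iff it is the lift of a record configuration. [cite: Balaban1987RG1, (0.1) p.251 (bookkeeping)] -/
theorem mem_ne3DomOfRecord₁₁_iff {K k : ℕ} (V' : (Fin 4 → ℤ) → Fin 4 → (MatA N)ˣ) :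
    V' ∈ ne3DomOfRecord₁₁ F N K k ↔ ∃ V : cfgOfRecord F N K k, liftCfgOfRecord₁₁ F N K k V = V' := Iff.rfl

/-- Every lift of a record configuration is a datum of record. [cite: Balaban1987RG1, (0.1) p.251 (bookkeeping)] -/
theorem liftCfgOfRecord₁₁_mem_ne3DomOfRecord₁₁ {K k : ℕ} (V : cfgOfRecord F N K k) :
    liftCfgOfRecord₁₁ F N K k V ∈ ne3DomOfRecord₁₁ F N K k := ⟨V, rfl⟩

variable (F N) in
/-- The data of record are non-empty (the trivial configuration `U ≡ 1` lifts). [cite: Balaban1987RG1, (0.1) p.251 (bookkeeping)] -/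
theorem ne3DomOfRecord₁₁_nonempty (K k : ℕ) : (ne3DomOfRecord₁₁ F N K k).Nonempty :=
  ⟨_, liftCfgOfRecord₁₁_mem_ne3DomOfRecord₁₁ (fun _ => 1)⟩

/-- **A DATUM OF RECORD IS `Nper`-PERIODIC IN EVERY INTEGER DIRECTION.** [cite: Balaban1987RG1, (0.1) p.251 (bookkeeping)] -/
theorem periodic_of_mem_ne3DomOfRecord₁₁ {K k : ℕ} {V' : (Fin 4 → ℤ) → Fin 4 → (MatA N)ˣ} (hV' : V' ∈ ne3DomOfRecord₁₁ F N K k)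
    (x v : Fin 4 → ℤ) (κ : Fin 4) : V' (x + (ne3NperOfRecord₁₁ F K k : ℤ) • v) κ = V' x κ := by
  obtain ⟨V, rfl⟩ := hV'
  exact liftCfgOfRecord₁₁_add_period_smul F N K k V x v κ

/-- **A DATUM OF RECORD IS `SU(N)`-VALUED** (through `M_N(ℂ)ˣ`). [cite: Balaban1987RG1, pp.251–252 (bookkeeping)] -/
theorem coe_mem_specialUnitaryGroup_of_mem_ne3DomOfRecord₁₁ {K k : ℕ} {V' : (Fin 4 → ℤ) → Fin 4 → (MatA N)ˣ}
    (hV' : V' ∈ ne3DomOfRecord₁₁ F N K k) (x : Fin 4 → ℤ) (κ : Fin 4) :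
    ((V' x κ : (MatA N)ˣ) : MatA N) ∈ Matrix.specialUnitaryGroup (Fin N) ℂ := by
  obtain ⟨V, rfl⟩ := hV'
  exact coe_liftCfgOfRecord₁₁_mem_specialUnitaryGroup F N K k V x κ

/-- **THE INTRINSIC READING (proved)**: the NE3 data of record at `(K, k)` are EXACTLY the `p`-periodic (`p = ne3NperOfRecord₁₁ F K k`, every integer
vector) unit-lattice configurations with values in `SU(N)`. [cite: Balaban1987RG1, (0.1) p.251 (bookkeeping)] -/
theorem ne3DomOfRecord₁₁_eq_setOf (K k : ℕ) :
    ne3DomOfRecord₁₁ F N K k =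
      {V' | (∀ (x v : Fin 4 → ℤ) (κ : Fin 4), V' (x + (ne3NperOfRecord₁₁ F K k : ℤ) • v) κ = V' x κ) ∧
        ∀ (x : Fin 4 → ℤ) (κ : Fin 4), ((V' x κ : (MatA N)ˣ) : MatA N) ∈ Matrix.specialUnitaryGroup (Fin N) ℂ} := by
  ext V'
  refine ⟨fun h => ⟨periodic_of_mem_ne3DomOfRecord₁₁ h, coe_mem_specialUnitaryGroup_of_mem_ne3DomOfRecord₁₁ h⟩, fun h => ?_⟩
  obtain ⟨hper, hsu⟩ := h
  -- the torus field under `V'`: read `V'` at the section of each torus site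
  refine ⟨fun b => ⟨(V' (fun μ : Fin 4 => ((b.src μ).val : ℤ)) b.dir : MatA N), hsu _ _⟩, ?_⟩
  funext x κ
  -- the section of `toTorusSite₁₁ x` differs from `x` by a period vector (stated at the `ℤ⁴` types)
  obtain ⟨v, hv⟩ : ∃ v : Fin 4 → ℤ,
      (fun μ : Fin 4 => (((toTorusSite₁₁ (F.P K) k x) μ).val : ℤ)) = x + (ne3NperOfRecord₁₁ F K k : ℤ) • v :=
    exists_eq_add_period_smul_of_toTorusSite₁₁_eq (P := F.P K) (j := k)
      (x := x) (x' := fun μ => (((toTorusSite₁₁ (F.P K) k x) μ).val : ℤ)) (toTorusSite₁₁_natCast_val _).symm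
  have key : V' (fun μ : Fin 4 => (((toTorusSite₁₁ (F.P K) k x) μ).val : ℤ)) κ = V' x κ := by
    rw [hv]
    exact hper x v κ
  apply Units.ext
  rw [coe_liftCfgOfRecord₁₁_apply]
  exact (congrArg Units.val key :)

/-- **`(K+1, k+1)` AND `(K, k)` GIVE THE SAME DATA** (the same unit lattice one approximation deeper). [cite: Balaban1987RG1, (0.1) p.251 (bookkeeping)] -/
theorem ne3DomOfRecord₁₁_succ (K k : ℕ) : ne3DomOfRecord₁₁ F N (K + 1) (k + 1) = ne3DomOfRecord₁₁ F N K k := by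
  rw [ne3DomOfRecord₁₁_eq_setOf, ne3DomOfRecord₁₁_eq_setOf, ne3NperOfRecord₁₁_succ]

/-- Membership by the intrinsic reading. [cite: Balaban1987RG1, (0.1) p.251 (bookkeeping)] -/
theorem mem_ne3DomOfRecord₁₁_iff_periodic_su {K k : ℕ} (V' : (Fin 4 → ℤ) → Fin 4 → (MatA N)ˣ) :
    V' ∈ ne3DomOfRecord₁₁ F N K k ↔
      (∀ (x v : Fin 4 → ℤ) (κ : Fin 4), V' (x + (ne3NperOfRecord₁₁ F K k : ℤ) • v) κ = V' x κ) ∧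
        ∀ (x : Fin 4 → ℤ) (κ : Fin 4), ((V' x κ : (MatA N)ˣ) : MatA N) ∈ Matrix.specialUnitaryGroup (Fin N) ℂ := by
  rw [ne3DomOfRecord₁₁_eq_setOf]
  rfl

end Data

/-! ## §4. The pinned NE3 object of the record (letters parametric) -/

/-- **N16's ANALYTIC LETTERS** `(ε, b, g, C, Λ₁, Λ₂')` — small-field radius, regularity letters, constants: PARAMETERS of the pin (they are THE END's;
`Thm/…N16RegimeDefs.InEndRegime ∕ radiusOfRecord ∕ constOfRecord` name them Summits-side). [cite: Balaban1985UV3, (1)-(3) p.256 (letters; objects only)] -/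
structure NE3Letters₁₁ where
  ε : ℝ
  b : ℝ
  g : ℝ
  C : ℝ
  Λ₁ : ℝ
  Λ₂' : ℝ

namespace NE3Objects₁₁

variable {N : ℕ}

/-- The analytic letters of an NE3 object. [cite: Balaban1985UV3, (1)-(3) p.256 (bookkeeping)] -/
def letters (o : NE3Objects₁₁ N) : NE3Letters₁₁ := ⟨o.ε, o.b, o.g, o.C, o.Λ₁, o.Λ₂'⟩

variable (F : T4Family) (N : ℕ)

/-- **N16's NE3 OBJECT OF THE RECORD** at approximation `K`, step `k`, with letters `ℓ`: period and unit-lattice data PINNED to the record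
(`ne3NperOfRecord₁₁`, `ne3DomOfRecord₁₁`), letters parametric. [cite: Balaban1987RG1, (0.1) p.251] -/
def ofRecord (K k : ℕ) (ℓ : NE3Letters₁₁) : NE3Objects₁₁ N :=
  ⟨ne3NperOfRecord₁₁ F K k, ℓ.ε, ℓ.b, ℓ.g, ℓ.C, ℓ.Λ₁, ℓ.Λ₂', ne3DomOfRecord₁₁ F N K k⟩

variable {F N}
variable (K k : ℕ) (ℓ : NE3Letters₁₁)

/-- Face (`rfl`). [cite: Balaban1987RG1, (0.1) p.251 (bookkeeping)] -/
theorem ofRecord_Nper : (ofRecord F N K k ℓ).Nper = ne3NperOfRecord₁₁ F K k := rfl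
/-- Face (`rfl`). [cite: Balaban1987RG1, (0.1) p.251 (bookkeeping)] -/
theorem ofRecord_dom : (ofRecord F N K k ℓ).dom = ne3DomOfRecord₁₁ F N K k := rfl
/-- Face (`rfl`). [cite: Balaban1985UV3, (1)-(3) p.256 (bookkeeping)] -/
theorem ofRecord_letters : (ofRecord F N K k ℓ).letters = ℓ := rfl
/-- Face (`rfl`). [cite: Balaban1985UV3, (1)-(3) p.256 (bookkeeping)] -/
theorem ofRecord_ε : (ofRecord F N K k ℓ).ε = ℓ.ε := rfl
/-- Face (`rfl`). [cite: Balaban1985UV3, (1)-(3) p.256 (bookkeeping)] -/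
theorem ofRecord_b : (ofRecord F N K k ℓ).b = ℓ.b := rfl
/-- Face (`rfl`). [cite: Balaban1985UV3, (1)-(3) p.256 (bookkeeping)] -/
theorem ofRecord_g : (ofRecord F N K k ℓ).g = ℓ.g := rfl
/-- Face (`rfl`). [cite: Balaban1985UV3, (1)-(3) p.256 (bookkeeping)] -/
theorem ofRecord_C : (ofRecord F N K k ℓ).C = ℓ.C := rfl
/-- Face (`rfl`). [cite: Balaban1985UV3, (1)-(3) p.256 (bookkeeping)] -/
theorem ofRecord_Λ₁ : (ofRecord F N K k ℓ).Λ₁ = ℓ.Λ₁ := rfl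
/-- Face (`rfl`). [cite: Balaban1985UV3, (1)-(3) p.256 (bookkeeping)] -/
theorem ofRecord_Λ₂' : (ofRecord F N K k ℓ).Λ₂' = ℓ.Λ₂' := rfl

/-- `1 ≤ Nper` for the object of record (THE END's regime clause, letter-level). [cite: Balaban1987RG1, (0.1) p.251 (bookkeeping)] -/
theorem one_le_ofRecord_Nper : 1 ≤ (ofRecord F N K k ℓ).Nper := one_le_ne3NperOfRecord₁₁ F K k

/-- **THE OBJECT OF RECORD IS POPULATED** (v1.1 §8: `dom.Nonempty`). [cite: Balaban1987RG1, (0.1) p.251 (bookkeeping)] -/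
theorem populated_ofRecord : (ofRecord F N K k ℓ).Populated := ne3DomOfRecord₁₁_nonempty F N K k

/-- `(K+1, k+1)` and `(K, k)` pin the same object (same letters). [cite: Balaban1987RG1, (0.1) p.251 (bookkeeping)] -/
theorem ofRecord_succ : ofRecord F N (K + 1) (k + 1) ℓ = ofRecord F N K k ℓ := by
  simp only [ofRecord, ne3NperOfRecord₁₁_succ, ne3DomOfRecord₁₁_succ]

end NE3Objects₁₁

/-! ## §5. The constant NE3 layer of record — the cell's reading of record (`K − k = 0`) -/

namespace NE3Objects₁₁

variable (F : T4Family) (N : ℕ)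

/-- **THE OBJECT OF RECORD ON THE DIAGONAL IS `K`-FREE**: `ofRecord F N K K ℓ = ofRecord F N 0 0 ℓ` (iterate `ofRecord_succ`). [cite: Balaban1987RG1, (0.1) p.251 (bookkeeping)] -/
theorem ofRecord_diag (K : ℕ) (ℓ : NE3Letters₁₁) : ofRecord F N K K ℓ = ofRecord F N 0 0 ℓ := by
  induction K with
  | zero => rfl
  | succ K ih => rw [ofRecord_succ]; exact ih

end NE3Objects₁₁

section ConstLayer

variable (F : T4Family) (N : ℕ)

/-- The period on the diagonal is `K`-free. [cite: Balaban1987RG1, (0.1) p.251 (bookkeeping)] -/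
theorem ne3NperOfRecord₁₁_diag (K : ℕ) : ne3NperOfRecord₁₁ F K K = ne3NperOfRecord₁₁ F 0 0 := by
  rw [ne3NperOfRecord₁₁_self, ne3NperOfRecord₁₁_self]

/-- The data on the diagonal are `K`-free. [cite: Balaban1987RG1, (0.1) p.251 (bookkeeping)] -/
theorem ne3DomOfRecord₁₁_diag (K : ℕ) : ne3DomOfRecord₁₁ F N K K = ne3DomOfRecord₁₁ F N 0 0 := by
  induction K with
  | zero => rfl
  | succ K ih => rw [ne3DomOfRecord₁₁_succ]; exact ih

/-- **THE CONSTANT NE3 LAYER OF RECORD** with letters `ℓ`: the NE3 object of record at `K − k = 0` — the PHYSICAL UNIT TORUS `Nper = 2·L^m` of every run's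
LAST step, `dom` = ALL `2·L^m`-periodic `SU(N)`-valued unit-lattice configurations.  This is the cell's READING OF RECORD of N16's bundle (pub-ymgap INBOX
l.13645 dag-n16-e ANSWER-RR1 (2); dag-lead DEDUP-198 l.13671 CONFIRMED): `N16At c` fixes ONE unit torus and itself quantifies every depth `k ≥ 1` beneath it,
so the NE3 component of a rate reading does NOT vary with the run length. [cite: Balaban1987RG1, (0.1) p.251; Balaban1985UV3, (1)-(3) p.256 (letters; objects only)] -/
def ne3ConstLayerOfRecord₁₁ (ℓ : NE3Letters₁₁) : NE3Objects₁₁ N := NE3Objects₁₁.ofRecord F N 0 0 ℓ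

/-- Face (`rfl`). [cite: Balaban1987RG1, (0.1) p.251 (bookkeeping)] -/
theorem ne3ConstLayerOfRecord₁₁_def (ℓ : NE3Letters₁₁) : ne3ConstLayerOfRecord₁₁ F N ℓ = NE3Objects₁₁.ofRecord F N 0 0 ℓ := rfl

/-- **EVERY DIAGONAL OBJECT OF RECORD IS THE CONSTANT LAYER**: `ofRecord F N K K ℓ = ne3ConstLayerOfRecord₁₁ F N ℓ`. [cite: Balaban1987RG1, (0.1) p.251 (bookkeeping)] -/
theorem ofRecord_self_eq_ne3ConstLayerOfRecord₁₁ (K : ℕ) (ℓ : NE3Letters₁₁) :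
    NE3Objects₁₁.ofRecord F N K K ℓ = ne3ConstLayerOfRecord₁₁ F N ℓ := NE3Objects₁₁.ofRecord_diag F N K ℓ

/-- Face: `Nper = 2·L^m`. [cite: Balaban1987RG1, (0.1) p.251 (bookkeeping)] -/
theorem ne3ConstLayerOfRecord₁₁_Nper (ℓ : NE3Letters₁₁) : (ne3ConstLayerOfRecord₁₁ F N ℓ).Nper = 2 * F.L ^ F.m := ne3NperOfRecord₁₁_self F 0

/-- Face (`rfl`): `Nper` is the period of record at `(0, 0)`. [cite: Balaban1987RG1, (0.1) p.251 (bookkeeping)] -/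
theorem ne3ConstLayerOfRecord₁₁_Nper_eq (ℓ : NE3Letters₁₁) : (ne3ConstLayerOfRecord₁₁ F N ℓ).Nper = ne3NperOfRecord₁₁ F 0 0 := rfl

/-- Face (`rfl`): `dom` is the data of record at `(0, 0)`. [cite: Balaban1987RG1, (0.1) p.251 (bookkeeping)] -/
theorem ne3ConstLayerOfRecord₁₁_dom (ℓ : NE3Letters₁₁) : (ne3ConstLayerOfRecord₁₁ F N ℓ).dom = ne3DomOfRecord₁₁ F N 0 0 := rfl

/-- Face (`rfl`). [cite: Balaban1985UV3, (1)-(3) p.256 (bookkeeping)] -/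
theorem ne3ConstLayerOfRecord₁₁_letters (ℓ : NE3Letters₁₁) : (ne3ConstLayerOfRecord₁₁ F N ℓ).letters = ℓ := rfl
/-- Face (`rfl`). [cite: Balaban1985UV3, (1)-(3) p.256 (bookkeeping)] -/
theorem ne3ConstLayerOfRecord₁₁_ε (ℓ : NE3Letters₁₁) : (ne3ConstLayerOfRecord₁₁ F N ℓ).ε = ℓ.ε := rfl
/-- Face (`rfl`). [cite: Balaban1985UV3, (1)-(3) p.256 (bookkeeping)] -/
theorem ne3ConstLayerOfRecord₁₁_b (ℓ : NE3Letters₁₁) : (ne3ConstLayerOfRecord₁₁ F N ℓ).b = ℓ.b := rfl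
/-- Face (`rfl`). [cite: Balaban1985UV3, (1)-(3) p.256 (bookkeeping)] -/
theorem ne3ConstLayerOfRecord₁₁_g (ℓ : NE3Letters₁₁) : (ne3ConstLayerOfRecord₁₁ F N ℓ).g = ℓ.g := rfl
/-- Face (`rfl`). [cite: Balaban1985UV3, (1)-(3) p.256 (bookkeeping)] -/
theorem ne3ConstLayerOfRecord₁₁_C (ℓ : NE3Letters₁₁) : (ne3ConstLayerOfRecord₁₁ F N ℓ).C = ℓ.C := rfl
/-- Face (`rfl`). [cite: Balaban1985UV3, (1)-(3) p.256 (bookkeeping)] -/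
theorem ne3ConstLayerOfRecord₁₁_Λ₁ (ℓ : NE3Letters₁₁) : (ne3ConstLayerOfRecord₁₁ F N ℓ).Λ₁ = ℓ.Λ₁ := rfl
/-- Face (`rfl`). [cite: Balaban1985UV3, (1)-(3) p.256 (bookkeeping)] -/
theorem ne3ConstLayerOfRecord₁₁_Λ₂' (ℓ : NE3Letters₁₁) : (ne3ConstLayerOfRecord₁₁ F N ℓ).Λ₂' = ℓ.Λ₂' := rfl

/-- `2 ≤ Nper` for the constant layer. [cite: Balaban1987RG1, (0.1) p.251 (bookkeeping)] -/
theorem two_le_ne3ConstLayerOfRecord₁₁_Nper (ℓ : NE3Letters₁₁) : 2 ≤ (ne3ConstLayerOfRecord₁₁ F N ℓ).Nper := two_le_ne3NperOfRecord₁₁ F 0 0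

/-- `1 ≤ Nper` for the constant layer (THE END's regime clause, letter-level). [cite: Balaban1987RG1, (0.1) p.251 (bookkeeping)] -/
theorem one_le_ne3ConstLayerOfRecord₁₁_Nper (ℓ : NE3Letters₁₁) : 1 ≤ (ne3ConstLayerOfRecord₁₁ F N ℓ).Nper := one_le_ne3NperOfRecord₁₁ F 0 0

/-- **THE CONSTANT LAYER IS POPULATED.** [cite: Balaban1987RG1, (0.1) p.251 (bookkeeping)] -/
theorem populated_ne3ConstLayerOfRecord₁₁ (ℓ : NE3Letters₁₁) : (ne3ConstLayerOfRecord₁₁ F N ℓ).Populated := ne3DomOfRecord₁₁_nonempty F N 0 0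

/-- **MEMBERSHIP IN THE CONSTANT LAYER'S DATA**: exactly the `2·L^m`-periodic (every integer vector) `SU(N)`-valued unit-lattice configurations.
[cite: Balaban1987RG1, (0.1) p.251 (bookkeeping)] -/
theorem mem_ne3ConstLayerOfRecord₁₁_dom_iff (ℓ : NE3Letters₁₁) (V' : (Fin 4 → ℤ) → Fin 4 → (MatA N)ˣ) :
    V' ∈ (ne3ConstLayerOfRecord₁₁ F N ℓ).dom ↔
      (∀ (x v : Fin 4 → ℤ) (κ : Fin 4), V' (x + ((2 * F.L ^ F.m : ℕ) : ℤ) • v) κ = V' x κ) ∧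
        ∀ (x : Fin 4 → ℤ) (κ : Fin 4), ((V' x κ : (MatA N)ˣ) : MatA N) ∈ Matrix.specialUnitaryGroup (Fin N) ℂ := by
  rw [ne3ConstLayerOfRecord₁₁_dom, mem_ne3DomOfRecord₁₁_iff_periodic_su, ne3NperOfRecord₁₁_self]

/-- **THE CONSTANT NE3 READING OF RECORD**: run length `k ↦` the constant layer (what layer B pins into `RateObjects.ne3`; a consumer's
`hconst : ∀ …, (reading).ne3 k = o F` is `fun … => rfl` with `o F := ne3ConstLayerOfRecord₁₁ F N (ℓ F)`). [cite: Balaban1987RG1, (0.1) p.251] -/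
def ne3ConstReadingOfRecord₁₁ (ℓ : NE3Letters₁₁) : ℕ → NE3Objects₁₁ N := fun _ => ne3ConstLayerOfRecord₁₁ F N ℓ

/-- Face (`rfl`). [cite: Balaban1987RG1, (0.1) p.251 (bookkeeping)] -/
theorem ne3ConstReadingOfRecord₁₁_apply (ℓ : NE3Letters₁₁) (k : ℕ) : ne3ConstReadingOfRecord₁₁ F N ℓ k = ne3ConstLayerOfRecord₁₁ F N ℓ := rfl

/-- **THE CONSTANT READING AT RUN LENGTH `k` IS THE OBJECT OF RECORD OF THAT RUN'S LAST STEP `(K, k) = (k, k)`.** [cite: Balaban1987RG1, (0.1) p.251 (bookkeeping)] -/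
theorem ne3ConstReadingOfRecord₁₁_eq_ofRecord_self (ℓ : NE3Letters₁₁) (k : ℕ) :
    ne3ConstReadingOfRecord₁₁ F N ℓ k = NE3Objects₁₁.ofRecord F N k k ℓ := (NE3Objects₁₁.ofRecord_diag F N k ℓ).symm

/-- Every value of the constant reading is populated. [cite: Balaban1987RG1, (0.1) p.251 (bookkeeping)] -/
theorem populated_ne3ConstReadingOfRecord₁₁ (ℓ : NE3Letters₁₁) (k : ℕ) : (ne3ConstReadingOfRecord₁₁ F N ℓ k).Populated :=
  populated_ne3ConstLayerOfRecord₁₁ F N ℓ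

end ConstLayer

end Literature.MathematicalPhysics.QuantumFieldTheory.Balaban1983to89.Node00

end
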